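import Literature.NumberTheory.ComplexMultiplication.ShimuraTaniyamaOfMainTheoremInertia
import Literature.AlgebraicGeometry.Motives.AbelianSchemeModelTateSpecialisation
import HarnessLib

/-!
# Shimura–Taniyama (row II-5) in SERRE–TATE currency: the family of Hecke characters of a CM structure, with «good reduction
# at `v`» read as «`A₀` has an abelian-scheme model over `𝓞_{k,v}`» — from the Main Theorem of CM ALONE
# ([Shimura 1998, Thm. 19.8, Prop. 19.10, Lemma 19.5, Thm. 19.11; Serre–Tate 1968 §1 (definition, Thm. 1 easy half), §7])

Topic `Literature/NumberTheory/ComplexMultiplication`, namespace `Literature.NumberTheory.ComplexMultiplication`.  THEOREMS ONLY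
(no definition, no named fact, no instance; net Literature debt **0**).  Cell `hodgecm-mathlib` (D-0151), the `h21` inertia chain.

[SerreTate1968] §1 DEFINES «`A` has good reduction at `v`» as: there is an abelian scheme over `𝓞_{K,v}` with generic fibre
`A` — the tree's `∃ (𝒜 : SchemeOver 𝓞_{K,v}) [GrpObj 𝒜], IsAbelianSchemeModel A v 𝒜` (`AbelianVarietyOrdinaryReduction`).  The
cell's `h21` chain instead keys «good reduction» on the tree's SCHEME-level `HasGoodReductionAt A.X A.dim v` (a smooth proper
model of the bare variety, `Motives/GoodReduction`), and then needs the bridge r₀ «a smooth proper model of an abelian variety is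
an abelian scheme» (`exists_isAbelianSchemeModel_of_hasGoodReductionAt`, [BLRNeronModels1990] 1.2/8 + Weil's theorem) to reach
the inertia statement `h₁₂` of Lemma 19.5 (A-p01 J-h12 08:11:49Z; director g3 BATCH 79).  In Serre–Tate's own currency that
step is a THEOREM of the tree (`IsAbelianSchemeModel.exists_primesAbove_forall_inertia_tateRep_eq_one`,
`AbelianSchemeModelTateSpecialisation` :223, over B-p07's Lemma 2 and B-p09's inertia corollary), so the whole of B-p21's FLAT
Shimura–Taniyama theorem (`shimuraTaniyama_heckeCharactersFlat_of_thm18_6_of_inertia`, `CasselmanOfMainTheoremInertiaFlat`)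
goes through with NO `h₁₂`, NO `h₃`, NO r₀ once clauses (4♭)/(5) are keyed on Serre–Tate's notion:

* `forall_inertia_tateRep_eq_one_of_exists_isAbelianSchemeModel`, `hasGoodReductionAt_of_exists_isAbelianSchemeModel` — the
  `∃ 𝒜`-forms (hypothesis VERBATIM the conclusion of the cofinite spreading theorem
  `AbelianVariety.exists_finite_forall_exists_isAbelianSchemeModel` and of r₀);
* `forall_localUnits_eq_one_of_exists_isAbelianSchemeModel_of_torsionReciprocity` — Thm. 19.11 first assertion, direction
  «good reduction ⟹ `α(𝔬_v^×) = 1`», at a Serre–Tate place, from A-p03/A-p01's inertia-keyed theorem with `h₁₂` DISCHARGED;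
* `shimuraTaniyama_heckeCharactersST_of_thm18_6 (h186)` — clauses (1), (2), (3) of `shimuraTaniyama_heckeCharacters` verbatim,
  (4ST) «abelian-scheme model at `v` ⟹ `χ_τ` unramified at `v`», (5ST) «abelian-scheme model at `v` ⟹ the Frobenius element
  `π ∈ 𝔬_K` with `χ_τ(ϖ_v) = τ(π)`, every arithmetic Frobenius at `v` acts on `T_ℓ A₀` as `T_ℓ(ι₀ π)`, `(π)` = reflex type norm»,
  from `shimura1998_thm18_6` (row II-1) ALONE;
* `shimuraTaniyama_heckeCharactersST_eventually_of_thm18_6` — (5ST) at COFINITELY many places with no hypothesis on the place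
  (the form every consumer of the cell reads: Casselman's «determines `χ`», [Liu2021] Def. 4.5 / Thm. 4.18 label separation),
  through `exists_finite_forall_exists_isAbelianSchemeModel` (★, `AbelianVarietyGoodReductionCofinite`).

READING.  This is the edition «E-ST» PRODUCER: it changes no definition and no binder; the binder `shimura1998_thm21_4_casselman`
and [Liu2021] Def. 4.5 (`Def45.IsCMCharacterMuAlgHecke`) still key their Frobenius clause on `HasGoodReductionAt A.X A.dim v`, and
re-keying them on Serre–Tate's notion is a director-declared END-HYP RETYPE (BATCH 114), not done here.  HC_CM is proved only modulo
the 7 printed citations until rung 0 closes; this file adds no hypothesis to anything and discharges no binder by itself.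

## References
* [Shimura1998] G. Shimura, *Abelian Varieties with Complex Multiplication and Modular Functions*, Princeton Univ. Press (1998):
  §19.7–19.11 — Thm. 19.8 (p. 134), Prop. 19.10 (19.10a)–(19.10f) (pp. 136–137), Lemma 19.5 (p. 133), Thm. 19.11 first assertion and
  its proof (pp. 137–138); §18.6 Thm. 18.6 (2); §8.5 Prop. 30.
* [SerreTate1968] J.-P. Serre, J. Tate, *Good reduction of abelian varieties*, Ann. of Math. 88 (1968), §1: definition of good
  reduction (p. 492), Thm. 1 (easy direction) and Lemma 2; §7 Thm. 10, Thm. 11 with Cor. 1, Thm. 12.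
* [BLRNeronModels1990] S. Bosch, W. Lütkebohmert, M. Raynaud, *Néron Models* (1990), §1.2 Prop. 8 (the bridge r₀, NOT used here).
-/

set_option autoImplicit false

noncomputable section
open CategoryTheory IsDedekindDomain IsDedekindDomain.HeightOneSpectrum NumberField
open scoped NumberField nonZeroDivisors ComplexConjugate

/-! ## §1. Serre–Tate §1 Thm. 1 (easy half) in the `∃`-model form -/

namespace Literature.NumberTheory.DiophantineGeometry

open Literature.AlgebraicGeometry.Motives
open Literature.NumberTheory.GaloisRepresentations

variable {K : Type} [Field K] [NumberField K] {A : AbelianVariety K} {v : HeightOneSpectrum (𝓞 K)}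

/-- **«`A` has good reduction at `v` in the sense of Serre–Tate ⟹ `T_ℓ A` is unramified at `v`»** ([SerreTate1968] §1 Thm. 1,
(a) ⇒ (c); [Shimura1998] Lemma 19.5): if `A` has SOME abelian-scheme model over `𝓞_{K,v}`, then for every prime `ℓ` with `(ℓ) ∉ v`
some prime `𝔓 ∣ v` of `ℤ̄_K` has inertia group acting trivially on `T_ℓ A` — the conclusion shape of the `h21` chain's hypothesis
`h₁₂`, with Serre–Tate's antecedent.  One line over `IsAbelianSchemeModel.exists_primesAbove_forall_inertia_tateRep_eq_one`.
[cite: SerreTate1968, §1 (definition of good reduction), Thm. 1 and Lemma 2] [cite: Shimura1998, Lemma 19.5 (p. 133)] -/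
theorem forall_inertia_tateRep_eq_one_of_exists_isAbelianSchemeModel
    (h : ∃ (𝒜 : SchemeOver (valuationSubringAtPrime K v)) (_ : GrpObj 𝒜), IsAbelianSchemeModel A v 𝒜)
    (ℓ : ℕ) [Fact ℓ.Prime] (hℓv : ((ℓ : ℕ) : 𝓞 K) ∉ v.asIdeal) :
    ∃ 𝔓 ∈ v.primesAbove, ∀ σ ∈ 𝔓.inertia (Field.absoluteGaloisGroup K), A.tateRep ℓ σ = 1 := by
  obtain ⟨𝒜, _, h𝒜⟩ := h
  exact h𝒜.exists_primesAbove_forall_inertia_tateRep_eq_one ℓ hℓv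

/-- **An abelian-scheme model is a smooth proper model of the variety** (`∃`-form of `IsAbelianSchemeModel.hasGoodReductionAt`):
Serre–Tate's good reduction implies the tree's scheme-level `HasGoodReductionAt A.X A.dim v`.  (The converse is the bridge r₀ —
not used in this file.) [cite: SerreTate1968, §1 (definition of good reduction, p. 492)] -/
theorem hasGoodReductionAt_of_exists_isAbelianSchemeModel
    (h : ∃ (𝒜 : SchemeOver (valuationSubringAtPrime K v)) (_ : GrpObj 𝒜), IsAbelianSchemeModel A v 𝒜) :
    HasGoodReductionAt A.X A.dim v := by
  obtain ⟨𝒜, _, h𝒜⟩ := h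
  exact h𝒜.hasGoodReductionAt

end Literature.NumberTheory.DiophantineGeometry

/-! ## §2. Thm. 19.11 (first assertion, one way) and the Shimura–Taniyama family in Serre–Tate currency -/

namespace Literature.NumberTheory.ComplexMultiplication

open Literature.AlgebraicGeometry.Motives
open Literature.NumberTheory.GaloisRepresentations
open Literature.NumberTheory.DiophantineGeometry (IsAbelianSchemeModel
  forall_inertia_tateRep_eq_one_of_exists_isAbelianSchemeModel hasGoodReductionAt_of_exists_isAbelianSchemeModel)
open Literature.NumberTheory.NumberFields.IdeleAction (ideleMulIdeal ideleMulEquiv)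
open Literature.NumberTheory.AdelicBaseChange (ideleRelNorm)
open Literature.NumberTheory.Automorphic.FiniteAdeleRing (toFractionalIdeal)

section Thm1911

variable {k : Type} [Field k] [NumberField k] [Algebra k ℂ] {K : Type} [Field K] [NumberField K]
  {Φ : CMType K} [NumberField ↥(traceField Φ)] [Algebra ↥(traceField Φ) k]
  {A₀ : AbelianVariety k} {ι₀ : 𝓞 K →+* End A₀} {𝔞 : (FractionalIdeal (𝓞 K)⁰ K)ˣ}
  (ξ : CMTypeUniformization Φ 𝔞 (A₀.baseChange ℂ) ((A₀.endBaseChange ℂ).comp ι₀))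
  (α : ideleGroup k →* Kˣ)

/-- **Shimura 1998 Thm. 19.11, first assertion, direction «good reduction modulo `𝔭` ⟹ `α(𝔬_𝔭^×) = 1`», at a SERRE–TATE place,
hypothesis-free in the reduction theory**: A-p03/A-p01's `forall_localUnits_eq_one_of_hasGoodReductionAt_of_torsionReciprocity_of_inertia`
with its inertia hypothesis `h₁₂` DISCHARGED by `forall_inertia_tateRep_eq_one_of_exists_isAbelianSchemeModel` and its scheme-level
`hgood` by `hasGoodReductionAt_of_exists_isAbelianSchemeModel`.
[cite: Shimura1998, Thm. 19.11 (first assertion) p. 138, Lemma 19.5 p. 133, Thm. 19.8 p. 134] [cite: SerreTate1968, §1 Thm. 1; §7 Thm. 11 Cor. 1] -/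
theorem forall_localUnits_eq_one_of_exists_isAbelianSchemeModel_of_torsionReciprocity
    (hrec : ∀ (σ : ℂ ≃ₐ[k] ℂ) (x : ideleGroup k), IsArtinLift k x σ → ∀ u v : K,
      ideleMulEquiv (FiniteAdeleRing.unitEmbedding (𝓞 K) K (α x) *
          (reflexNormFinitePart K Φ (traceField Φ) (ideleRelNorm (↥(traceField Φ)) k x))⁻¹)
        (𝔞 : FractionalIdeal (𝓞 K)⁰ K) 𝔞.ne_zero (Submodule.Quotient.mk u) = Submodule.Quotient.mk v →
      σ • (A₀.pointsMulEquiv ℂ).symm (ξ.r u) = (A₀.pointsMulEquiv ℂ).symm (ξ.r v))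
    {v : HeightOneSpectrum (𝓞 k)}
    (hαv : ∀ u : (v.adicCompletionIntegers k)ˣ, ∃ b : 𝓞 K,
      (b : K) = α (localUnits v (Units.map ((v.adicCompletionIntegers k).subtype : _ →* _) u)))
    (hv : ∃ (𝒜 : SchemeOver (valuationSubringAtPrime k v)) (_ : GrpObj 𝒜), IsAbelianSchemeModel A₀ v 𝒜)
    (u : (v.adicCompletionIntegers k)ˣ) :
    α (localUnits v (Units.map ((v.adicCompletionIntegers k).subtype : _ →* _) u)) = 1 :=
  forall_localUnits_eq_one_of_hasGoodReductionAt_of_torsionReciprocity_of_inertia ξ α hrec hαv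
    (fun _ ℓ _ hℓ => forall_inertia_tateRep_eq_one_of_exists_isAbelianSchemeModel hv ℓ hℓ)
    (hasGoodReductionAt_of_exists_isAbelianSchemeModel hv) u

end Thm1911

/-- **SHIMURA–TANIYAMA IN SERRE–TATE CURRENCY (Shimura 1998 Thm. 19.8 / Prop. 19.10 / Lemma 19.5 / Thm. 19.11 = Serre–Tate 1968 §7
Thms. 10–12 with §1 Thm. 1, easy half) FROM THE MAIN THEOREM OF COMPLEX MULTIPLICATION ALONE.**  ASSUMING `shimura1998_thm18_6`
(row II-1) and NOTHING ELSE: every structure `(A₀, ι₀)` of type `(K, Φ)` over a number field `k ⊂ ℂ` has a family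
`(χ_τ)_{τ : K → ℂ}` of Hecke characters of `k` with (1) infinity types `cmInfinityType Φ τ σ₀` (19.10a,c), (2) `χ_{τ̄} = conj χ_τ`
(19.10d), (3) on local idèles the family of embeddings of one element of `K` (19.10b,c), (4ST) «`A₀` has an abelian-scheme model over
`𝓞_{k,v}` ⟹ `χ_τ` is unramified at `v`» (Thm. 19.11 ⟸-half = Lemma 19.5, good reduction in the sense of [SerreTate1968] §1),
(5ST) at every such place the Frobenius element `π ∈ 𝔬_K`: `χ_τ(ϖ_v) = τ(π)`, every arithmetic Frobenius at `v` acts on `T_ℓ A₀`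
(`ℓ ∤ v`) as `T_ℓ(ι₀ π)`, and `(π)` is the reflex type norm of `𝔭_v` in every normal presentation.  Proof = B-p21's
`shimuraTaniyama_heckeCharactersFlat_of_thm18_6_of_inertia`, steps 1–4 verbatim, step 5 :=
`forall_localUnits_eq_one_of_exists_isAbelianSchemeModel_of_torsionReciprocity` (no `h₁₂`).
[cite: Shimura1998, §19.7–19.11: Thm. 19.8 (p. 134), Prop. 19.10 (19.10a–f) (pp. 136–137), Lemma 19.5 (p. 133), Thm. 19.11 and its proof (pp. 137–138); §18.6 Thm. 18.6 (2); §8.5 Prop. 30]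
[cite: SerreTate1968, §1 (definition of good reduction), Thm. 1; §7 Thm. 10, Thm. 11 with Cor. 1, Thm. 12] -/
theorem shimuraTaniyama_heckeCharactersST_of_thm18_6 (h186 : shimura1998_thm18_6) :
    ∀ (k : Type) [Field k] [NumberField k] [Algebra k ℂ] (K : Type) [Field K] [NumberField K]
      [IsCMField K] (Φ : CMType K) (A₀ : AbelianVariety k) (ι₀ : 𝓞 K →+* End A₀),
      IsCMTypeRealisationOver Φ A₀ ι₀ →
      ∃ χ : (K →+* ℂ) → HeckeCharacter k,
        -- (1) infinity type (19.10a,c)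
        (∀ τ : K →+* ℂ, (χ τ).HasInfinityType (cmInfinityType Φ.1 τ (algebraMap k ℂ)).1
          (cmInfinityType Φ.1 τ (algebraMap k ℂ)).2) ∧
        -- (2) conjugation (19.10d)
        (∀ (τ : K →+* ℂ) (x : ideleGroup k),
          ((χ (ComplexEmbedding.conjugate τ) x : ℂˣ) : ℂ) = conj ((χ τ x : ℂˣ) : ℂ)) ∧
        -- (3) values in `K` on finite local ideles (19.10b,c)
        (∀ (v : HeightOneSpectrum (𝓞 k)) (u : (v.adicCompletion k)ˣ),
          ∃ b : K, ∀ τ : K →+* ℂ, ((χ τ (localUnits v u) : ℂˣ) : ℂ) = τ b) ∧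
        -- (4ST) abelian-scheme model ⟹ unramified (Thm. 19.11, ⟸-half; Lemma 19.5; Serre–Tate §1)
        (∀ (τ : K →+* ℂ) (v : HeightOneSpectrum (𝓞 k)),
          (∃ (𝒜 : SchemeOver (valuationSubringAtPrime k v)) (_ : GrpObj 𝒜), IsAbelianSchemeModel A₀ v 𝒜) →
            (χ τ).IsUnramifiedAt v) ∧
        -- (5ST) the Frobenius element at a Serre–Tate place
        (∀ v : HeightOneSpectrum (𝓞 k),
          (∃ (𝒜 : SchemeOver (valuationSubringAtPrime k v)) (_ : GrpObj 𝒜), IsAbelianSchemeModel A₀ v 𝒜) →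
          ∃ π : 𝓞 K,
            (∀ τ : K →+* ℂ, (χ τ).valueAtUniformizer v = τ (π : K)) ∧
            (∀ (ℓ : ℕ) [Fact ℓ.Prime], (ℓ : 𝓞 k) ∉ v.asIdeal →
              ∀ 𝔓 ∈ v.primesAbove, ∀ σ : Field.absoluteGaloisGroup k, IsArithFrobAt (𝓞 k) σ 𝔓 →
                A₀.tateRep ℓ σ = AbelianVariety.tateModuleMap ℓ (ι₀ π : A₀ ⟶ A₀)) ∧
            (∀ (L : Type) [Field L] [NumberField L] [Normal ℚ L] (ιL : L →+* ℂ) (j : K →+* L)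
              (σL : k →+* L), ιL.comp σL = algebraMap k ℂ →
                IsReflexTypeNorm (valuedIn ιL Φ.1) j σL v.asIdeal (Ideal.span {π}))) := by
  intro k _ _ _ K _ _ _ Φ A₀ ι₀ h
  classical
  -- 1. `K* ⊆ k` (Prop. 30) as instances
  have hK : ((traceField Φ : Set ℂ)) ⊆ Set.range (algebraMap k ℂ) := fun x hx => by
    have h' := h.traceField_le_fieldRange (show x ∈ (traceField Φ).toSubfield from hx)
    exact RingHom.mem_fieldRange.1 h'
  obtain ⟨_, _⟩ := exists_algebra_isScalarTower_of_subset_range (traceField Φ) k hK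
  haveI : NumberField (traceField Φ) := NumberField.mk
  -- 2. «We take `𝔞` so that (18.4a) holds»
  obtain ⟨𝔞, ⟨ξ⟩⟩ := h.exists_cmTypeUniformization
  -- 3. Thm. 19.8: `α`, lattice clause, reciprocity, `α = N_Φ` on `k^×`, `Ker(α)` open
  obtain ⟨α, hL, hR, hprin⟩ := exists_hom_torsion_reciprocity ξ h186
  have hideal : ∀ x : ideleGroup k, FractionalIdeal.spanSingleton (𝓞 K)⁰ ((α x : Kˣ) : K) =
      Literature.NumberTheory.Automorphic.FiniteAdeleRing.toFractionalIdeal (𝓞 K) K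
        (reflexNormFinitePart K Φ (traceField Φ) (Literature.NumberTheory.AdelicBaseChange.ideleRelNorm (↥(traceField Φ)) k x)) :=
    fun x => spanSingleton_eq_toFractionalIdeal_of_ideleMulIdeal_eq (hL x)
  have hker : IsOpen ((α.ker : Subgroup (ideleGroup k)) : Set (ideleGroup k)) := isOpen_ker_of_torsion_reciprocity ξ α hL hR
  -- 4. Prop. 19.10: the Hecke characters
  obtain ⟨χ, -, h1, h2, h3, hunr, hunits, h5⟩ := exists_heckeCharacters_of_isOpen_ker α hker hprin hideal
  -- 5ST. Thm. 19.11, ⟸-half (Lemma 19.5): at a Serre–Tate place `α(𝔬_v^×) = 1`, no hypothesis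
  have h4 : ∀ v : HeightOneSpectrum (𝓞 k),
      (∃ (𝒜 : SchemeOver (valuationSubringAtPrime k v)) (_ : GrpObj 𝒜), IsAbelianSchemeModel A₀ v 𝒜) →
      ∀ u : (v.adicCompletionIntegers k)ˣ,
        α (localUnits v (Units.map ((v.adicCompletionIntegers k).subtype : _ →* _) u)) = 1 := fun v hv u =>
    forall_localUnits_eq_one_of_exists_isAbelianSchemeModel_of_torsionReciprocity ξ α hR
      (fun u => by
        obtain ⟨b, hb⟩ := hunits v u
        exact ⟨(b : 𝓞 K), hb.symm⟩)
      hv u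
  refine ⟨χ, h1, h2, h3, fun τ v hv => (hunr τ v).2 (h4 v hv), fun v hv => ?_⟩
  obtain ⟨π, hπ, h5a, h5c⟩ := h5 v
  refine ⟨π, h5a, fun ℓ _ hℓ 𝔓 h𝔓 σ hσ => ?_, h5c⟩
  exact tateRep_eq_tateModuleMap_of_isArithFrobAt_of_torsionReciprocity ξ α hR (h4 v hv) hπ.symm hℓ h𝔓 hσ

/-- **(5ST) at COFINITELY many places, with no hypothesis on the place** — the form the cell's consumers read ([Shimura1998] Thm. 21.4
«determines `χ`»: the two Frobenius descriptions are compared at almost all places; [Liu2021] Def. 4.5 / proof of Thm. 4.18 l. 2263: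
Frobenius at almost all places by Chebotarev): from `shimura1998_thm18_6` ALONE, every structure `(A₀, ι₀)` of type `(K, Φ)` over `k`
has a family `(χ_τ)` with clauses (1)–(3) and, for all `v` outside a finite set, the Frobenius element `π` of (5ST).  The finite set is
the bad set of the abelian-scheme spread of `A₀` (`AbelianVariety.exists_finite_forall_exists_isAbelianSchemeModel`, ★
`AbelianVarietyGoodReductionCofinite` — spreading out the GROUP law, [Milne1986AbelianVarieties] Rem. 20.9); no r₀, no `h₁₂`, no `h₃`.
[cite: Shimura1998, Prop. 19.10, Lemma 19.5, Thm. 19.11 (proof); §21.4 Thm. 21.4 (proof, p. 192)] [cite: SerreTate1968, §1 Thm. 1; §7 Thm. 10–12] -/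
theorem shimuraTaniyama_heckeCharactersST_eventually_of_thm18_6 (h186 : shimura1998_thm18_6) :
    ∀ (k : Type) [Field k] [NumberField k] [Algebra k ℂ] (K : Type) [Field K] [NumberField K]
      [IsCMField K] (Φ : CMType K) (A₀ : AbelianVariety k) (ι₀ : 𝓞 K →+* End A₀),
      IsCMTypeRealisationOver Φ A₀ ι₀ →
      ∃ χ : (K →+* ℂ) → HeckeCharacter k,
        (∀ τ : K →+* ℂ, (χ τ).HasInfinityType (cmInfinityType Φ.1 τ (algebraMap k ℂ)).1
          (cmInfinityType Φ.1 τ (algebraMap k ℂ)).2) ∧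
        (∀ (τ : K →+* ℂ) (x : ideleGroup k),
          ((χ (ComplexEmbedding.conjugate τ) x : ℂˣ) : ℂ) = conj ((χ τ x : ℂˣ) : ℂ)) ∧
        (∀ (v : HeightOneSpectrum (𝓞 k)) (u : (v.adicCompletion k)ˣ),
          ∃ b : K, ∀ τ : K →+* ℂ, ((χ τ (localUnits v u) : ℂˣ) : ℂ) = τ b) ∧
        (∀ᶠ v : HeightOneSpectrum (𝓞 k) in Filter.cofinite,
          ∃ π : 𝓞 K,
            (∀ τ : K →+* ℂ, (χ τ).valueAtUniformizer v = τ (π : K)) ∧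
            (∀ (ℓ : ℕ) [Fact ℓ.Prime], (ℓ : 𝓞 k) ∉ v.asIdeal →
              ∀ 𝔓 ∈ v.primesAbove, ∀ σ : Field.absoluteGaloisGroup k, IsArithFrobAt (𝓞 k) σ 𝔓 →
                A₀.tateRep ℓ σ = AbelianVariety.tateModuleMap ℓ (ι₀ π : A₀ ⟶ A₀)) ∧
            (∀ (L : Type) [Field L] [NumberField L] [Normal ℚ L] (ιL : L →+* ℂ) (j : K →+* L)
              (σL : k →+* L), ιL.comp σL = algebraMap k ℂ →
                IsReflexTypeNorm (valuedIn ιL Φ.1) j σL v.asIdeal (Ideal.span {π}))) := by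
  intro k _ _ _ K _ _ _ Φ A₀ ι₀ h
  obtain ⟨χ, h1, h2, h3, -, h5⟩ := shimuraTaniyama_heckeCharactersST_of_thm18_6 h186 k K Φ A₀ ι₀ h
  obtain ⟨S, hS, hout⟩ := AbelianVariety.exists_finite_forall_exists_isAbelianSchemeModel A₀
  refine ⟨χ, h1, h2, h3, ?_⟩
  exact Filter.eventually_cofinite.2 (hS.subset fun v hv => by
    by_contra hvS
    exact hv (h5 v (hout v hvS)))

end Literature.NumberTheory.ComplexMultiplication

end
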